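import Summits.NavierStokesRegularity.FunctionalMining.StretchingLaminateBurkholderLimit
import Mathlib.Tactic.Linarith
import Mathlib.Tactic.FieldSimp
import HarnessLib

/-!
# FunctionalMining — K1-Q1 laminates, L-CAP-B kernel port (3): the tree inequality `(TB)` from the concavity clause

search for candidate a priori estimates; no regularity claim.

Cell `pub-nsfunc` (host summit NavierStokesRegularity, topic `FunctionalMining`), prove seat gen 7.  Part of the
kernel port of the bank seat's THEOREM L-CAP-B (`HOME/pub-nsfunc-bank/K1Q1-LAMINATE-BURKHOLDER.md` §1–§3, §7–§8; dict typing
notes 134/134a): `Burkholder1991_keyFunction → C_lam ≤ 49/50`, a cap on the laminate METHOD for the stretching constant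
(`C_lam = laminateSupConst`), CONDITIONAL on the vendored Literature named fact `Burkholder1991_keyFunction` (Burkholder 1991,
LNM 1464, §8: the key function `u_λ` of Thm 8.1; only its CONCAVITY clause is used, always as an explicit hypothesis `hBK`).
Nothing in this file is a statement about Navier–Stokes solutions, and `C⋆ = stretchingSupConst` is not touched.

THIS FILE — `(TB)` (bank §2): **for every valid rational div-free lamination tree with `M²(𝒯) ≤ V = M²` and every
`λ > 2`, `Σ_L W_L u_λ(ω_L/M, √2·S_L/M) ≤ ᾱ_λ = (e²/4)e^{−λ}`** (`Tree.leafSumR_burkNode_root_le`, conditional on `hBK`).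
Route (prove g7; avoids both the boundary-corner lemma of note 134 and the filtration bookkeeping of 134a): the concavity
clause in `E6 = ℝ⁶` (`burk_concaveOn`, two independent vectors `E6_two_indep`) gives the two-point super-split inequality
(`burk_two_point`); on the SCALED dictionary `x ↦ σx`, `y ↦ σ²y` (`0 < σ < 1`) every node lies in the closed ball and the
strain increment is STRICTLY subordinate (`‖σ²k‖ < ‖σh‖` since `‖k‖ = ‖h‖` on a div-free split; the degenerate split `h = 0`
has `k = 0`), so `l·u_σ(G₊) + (1−l)·u_σ(G₋) ≤ u_σ(G)` (split weight `l ∈ [0,1]`; `λ` is Burkholder's parameter) at every split of a tree with `|ω| ≤ M` (`burkNodeS_supersplit`);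
induction down the tree (`leafSumR_burkNodeS_le`, the supermartingale principle of (bb) with the ball constraint threaded
as in (au)); finally `σ → 1⁻` leaf by leaf (`…BurkholderLimit`).  Standard axioms only; the named fact enters as `hBK`.
-/

noncomputable section

namespace Summit.NavierStokesRegularity.FunctionalMining

namespace Laminate

open Burk Literature.Probability.Process Filter Topology

/-- `E6 = ℝ⁶` has two linearly independent vectors (the hypothesis "real dimension at least two" of the named fact).
[ours; bookkeeping] -/
theorem E6_two_indep : ∃ v w : E6, LinearIndependent ℝ ![v, w] := by
  refine ⟨EuclideanSpace.single 0 1, EuclideanSpace.single 1 1, LinearIndependent.pair_iff.2 fun s t hst => ?_⟩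
  have h0 := congrArg (fun f : E6 => f 0) hst
  have h1 := congrArg (fun f : E6 => f 1) hst
  simp at h0 h1
  exact ⟨h0, h1⟩

/-- **The concavity clause of the Burkholder named fact, in `E6`**: for `‖x‖ ≤ 1`, `‖x + h‖ ≤ 1`, `‖k‖ < ‖h‖`, the
function `t ↦ u_λ(x + th, y + tk)` is concave on `{t : ‖x + th‖ ≤ 1}` (`λ > 2`). [ours; conditional on the
named fact `Burkholder1991_keyFunction`] -/
theorem burk_concaveOn (hBK : Burkholder1991_keyFunction) {lam : ℝ} (hlam : 2 < lam) (x y h k : E6)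
    (hx : ‖x‖ ≤ 1) (hxh : ‖x + h‖ ≤ 1) (hk : ‖k‖ < ‖h‖) :
    ConcaveOn ℝ {t : ℝ | ‖x + t • h‖ ≤ 1} (fun t => burkholderU lam (x + t • h) (y + t • k)) :=
  (hBK E6 E6_two_indep lam hlam).2 x y h k hx hxh hk

/-- **Two-point (super-split) inequality from concavity**: with weights `l, 1−l` and the `−` child at parameter
`t₂ = −l/(1−l)` on the line through the parent (`t = 0`) and the `+` child (`t = 1`):
`l·u(x + h, y + k) + (1−l)·u(x + t₂h, y + t₂k) ≤ u(x, y)`. [ours; elementary, conditional on the named fact] -/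
theorem burk_two_point (hBK : Burkholder1991_keyFunction) {lam : ℝ} (hlam : 2 < lam) {l : ℝ} (hl0 : 0 < l)
    (hl1 : l < 1) (x y h k : E6) (hx : ‖x‖ ≤ 1) (hxp : ‖x + h‖ ≤ 1) (hxm : ‖x + (-(l / (1 - l))) • h‖ ≤ 1)
    (hk : ‖k‖ < ‖h‖) :
    l * burkholderU lam (x + h) (y + k)
        + (1 - l) * burkholderU lam (x + (-(l / (1 - l))) • h) (y + (-(l / (1 - l))) • k)
      ≤ burkholderU lam x y := by
  have hc := burk_concaveOn hBK hlam x y h k hx hxp hk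
  have h1 : (1 : ℝ) ∈ {t : ℝ | ‖x + t • h‖ ≤ 1} := by simpa using hxp
  have h2 : (-(l / (1 - l))) ∈ {t : ℝ | ‖x + t • h‖ ≤ 1} := hxm
  have key := hc.2 h1 h2 (show (0 : ℝ) ≤ l from hl0.le) (show (0 : ℝ) ≤ 1 - l by linarith) (by ring)
  have ht : l • (1 : ℝ) + (1 - l) • (-(l / (1 - l))) = 0 := by
    simp only [smul_eq_mul]
    have : (1 - l) ≠ 0 := by linarith
    field_simp
    ring
  rw [ht] at key
  simpa [smul_eq_mul] using key

/-- A node with `|ω|² ≤ M²` has `‖x(G)‖ ≤ 1` (`M > 0`). [ours; bookkeeping] -/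
theorem norm_xVec_le_one {M : ℝ} (hM : 0 < M) (G : Grad) (hG : (G.vortSq : ℝ) ≤ M ^ 2) : ‖G.xVec M‖ ≤ 1 := by
  rw [Grad.norm_xVec hM, div_le_one hM]
  calc Real.sqrt (G.vortSq : ℝ) ≤ Real.sqrt (M ^ 2) := Real.sqrt_le_sqrt hG
    _ = M := Real.sqrt_sq hM.le

/-- **Super-split inequality for the SCALED node functional** at a div-free split whose node and children satisfy
`|ω|² ≤ M²` (`0 < σ < 1`, `λ > 2`): `l·u_σ(G₊) + (1−l)·u_σ(G₋) ≤ u_σ(G)` (split weight `l`), `u_σ = burkNodeS λ M σ`.  The scaling makes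
`‖σ²k‖ < ‖σh‖` strict (when `h ≠ 0`; when `h = 0` the three values coincide), so the STRICT concavity clause of the
named fact applies. [ours; conditional on the named fact] -/
theorem burkNodeS_supersplit (hBK : Burkholder1991_keyFunction) {lam : ℝ} (hlam : 2 < lam) {M : ℝ} (hM : 0 < M)
    {σ : ℝ} (hσ0 : 0 < σ) (hσ1 : σ < 1) (G : Grad) (s : Split) (h0 : 0 < s.lam) (h1 : s.lam < 1)
    (hdot : s.dot = 0) (hG : (G.vortSq : ℝ) ≤ M ^ 2) (hGp : ((G.layer (1 - s.lam) s).vortSq : ℝ) ≤ M ^ 2)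
    (hGm : ((G.layer (-s.lam) s).vortSq : ℝ) ≤ M ^ 2) :
    (s.lam : ℝ) * burkNodeS lam M σ (G.layer (1 - s.lam) s)
        + (1 - (s.lam : ℝ)) * burkNodeS lam M σ (G.layer (-s.lam) s)
      ≤ burkNodeS lam M σ G := by
  have hl0 : (0 : ℝ) < s.lam := by exact_mod_cast h0
  have hl1 : (s.lam : ℝ) < 1 := by exact_mod_cast h1
  have h1l : (1 : ℝ) - s.lam ≠ 0 := by linarith
  obtain ⟨x, hx⟩ : ∃ x : E6, x = σ • G.xVec M := ⟨_, rfl⟩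
  obtain ⟨y, hy⟩ : ∃ y : E6, y = σ ^ 2 • G.yVec M := ⟨_, rfl⟩
  obtain ⟨h, hh⟩ : ∃ h : E6, h = (σ * (1 - s.lam)) • s.hVec M := ⟨_, rfl⟩
  obtain ⟨k, hk⟩ : ∃ k : E6, k = (σ ^ 2 * (1 - s.lam)) • s.kVec M := ⟨_, rfl⟩
  have ht : (-((s.lam : ℝ) / (1 - s.lam))) * (σ * (1 - s.lam)) = σ * (((-s.lam : ℚ)) : ℝ) := by
    push_cast; field_simp
  have ht2 : (-((s.lam : ℝ) / (1 - s.lam))) * (σ ^ 2 * (1 - s.lam)) = σ ^ 2 * (((-s.lam : ℚ)) : ℝ) := by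
    push_cast; field_simp
  have hp1 : σ * (1 - (s.lam : ℝ)) = σ * (((1 - s.lam : ℚ)) : ℝ) := by push_cast; ring
  have hp2 : σ ^ 2 * (1 - (s.lam : ℝ)) = σ ^ 2 * (((1 - s.lam : ℚ)) : ℝ) := by push_cast; ring
  -- the three points on the line
  have exP : σ • (G.layer (1 - s.lam) s).xVec M = x + h := by
    rw [Grad.xVec_layer, smul_add, hx, hh, smul_smul, hp1]
  have eyP : σ ^ 2 • (G.layer (1 - s.lam) s).yVec M = y + k := by
    rw [Grad.yVec_layer, smul_add, hy, hk, smul_smul, hp2]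
  have exM : σ • (G.layer (-s.lam) s).xVec M = x + (-((s.lam : ℝ) / (1 - s.lam))) • h := by
    rw [Grad.xVec_layer, smul_add, hx, hh, smul_smul, smul_smul, ht]
  have eyM : σ ^ 2 • (G.layer (-s.lam) s).yVec M = y + (-((s.lam : ℝ) / (1 - s.lam))) • k := by
    rw [Grad.yVec_layer, smul_add, hy, hk, smul_smul, smul_smul, ht2]
  simp only [burkNodeS]
  rw [exP, eyP, exM, eyM, ← hx, ← hy]
  -- norms
  have hx1 : ‖x‖ ≤ 1 := by
    rw [hx, norm_smul, Real.norm_eq_abs, abs_of_pos hσ0]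
    have := norm_xVec_le_one hM G hG
    nlinarith [norm_nonneg (G.xVec M)]
  have hxp : ‖x + h‖ ≤ 1 := by
    rw [← exP, norm_smul, Real.norm_eq_abs, abs_of_pos hσ0]
    have := norm_xVec_le_one hM _ hGp
    nlinarith [norm_nonneg ((G.layer (1 - s.lam) s).xVec M)]
  have hxm : ‖x + (-((s.lam : ℝ) / (1 - s.lam))) • h‖ ≤ 1 := by
    rw [← exM, norm_smul, Real.norm_eq_abs, abs_of_pos hσ0]
    have := norm_xVec_le_one hM _ hGm
    nlinarith [norm_nonneg ((G.layer (-s.lam) s).xVec M)]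
  -- degenerate split: h = 0 (then k = 0 and the three values coincide)
  by_cases hh0 : s.hVec M = 0
  · have hk0 : s.kVec M = 0 := by
      have := Split.norm_kVec_eq M s hdot
      rw [hh0, norm_zero] at this
      exact norm_eq_zero.1 this
    have h0' : h = 0 := by rw [hh, hh0, smul_zero]
    have k0' : k = 0 := by rw [hk, hk0, smul_zero]
    rw [h0', k0']
    simp only [smul_zero, add_zero]
    linarith
  -- generic split: strict subordination after scaling
  have hkh : ‖k‖ < ‖h‖ := by
    rw [hh, hk, norm_smul, norm_smul, Split.norm_kVec_eq M s hdot, Real.norm_eq_abs, Real.norm_eq_abs,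
      abs_of_pos (by positivity), abs_of_pos (by positivity)]
    have hpos : 0 < ‖s.hVec M‖ := norm_pos_iff.2 hh0
    have hσ2 : σ ^ 2 * (1 - (s.lam : ℝ)) < σ * (1 - s.lam) := by
      have : σ ^ 2 < σ := by nlinarith
      exact mul_lt_mul_of_pos_right this (by linarith)
    exact mul_lt_mul_of_pos_right hσ2 hpos
  exact burk_two_point hBK hlam hl0 hl1 x y h k hx1 hxp hxm hkh

namespace Tree

/-- **(TB) for the scaled functional, down a valid tree**: below a node in state `G` with weight `W ≥ 0` on a valid tree
whose nodes obey `|ω|² ≤ M²` (leaf sup `≤ V = M²`): `Σ_L W_L u_σ(G_L) ≤ W·u_σ(G)` (`0 < σ < 1`). [ours; conditional] -/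
theorem leafSumR_burkNodeS_le (hBK : Burkholder1991_keyFunction) {lam : ℝ} (hlam : 2 < lam) {M : ℝ} (hM : 0 < M)
    {σ : ℝ} (hσ0 : 0 < σ) (hσ1 : σ < 1) {V : ℚ} (hV : ((V : ℚ) : ℝ) = M ^ 2) (T : Tree) (hT : T.valid = true) :
    ∀ (G : Grad) (W : ℚ), 0 ≤ W → T.vortSupFrom G ≤ V →
      T.leafSumR (burkNodeS lam M σ) G W ≤ (W : ℝ) * burkNodeS lam M σ G := by
  induction T with
  | leaf => intro G W _ _; simp [leafSumR]
  | node s p m ihp ihm =>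
      intro G W hW hsup
      obtain ⟨h0, h1, hdot, hp, hm⟩ := valid_node hT
      have hc := vortSupFrom_children s p m G
      have hsupP := hc.1.trans hsup
      have hsupM := hc.2.trans hsup
      have cast : ∀ {q : ℚ}, q ≤ V → ((q : ℚ) : ℝ) ≤ M ^ 2 := fun hq => by rw [← hV]; exact_mod_cast hq
      have hvG : (G.vortSq : ℝ) ≤ M ^ 2 := cast ((vortSq_le_vortSupFrom (node s p m) hT G).trans hsup)
      have hvp : ((G.layer (1 - s.lam) s).vortSq : ℝ) ≤ M ^ 2 := cast ((vortSq_le_vortSupFrom p hp _).trans hsupP)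
      have hvm : ((G.layer (-s.lam) s).vortSq : ℝ) ≤ M ^ 2 := cast ((vortSq_le_vortSupFrom m hm _).trans hsupM)
      have hP := ihp hp (G.layer (1 - s.lam) s) (W * s.lam) (mul_nonneg hW h0.le) hsupP
      have hM' := ihm hm (G.layer (-s.lam) s) (W * (1 - s.lam)) (mul_nonneg hW (by linarith)) hsupM
      have hnode := burkNodeS_supersplit hBK hlam hM hσ0 hσ1 G s h0 h1 hdot hvG hvp hvm
      have hWR : (0 : ℝ) ≤ (W : ℝ) := by exact_mod_cast hW
      simp only [leafSumR]
      push_cast at hP hM' ⊢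
      nlinarith [mul_le_mul_of_nonneg_left hnode hWR]

/-- **(TB), scaled, at the root**: `Σ_L W_L u_λ(σ x_L, σ² y_L) ≤ ᾱ_λ` for every valid tree with `M²(𝒯) ≤ V = M²`,
`0 < σ < 1`, `λ > 2`. [ours; conditional on the named fact] -/
theorem leafSumR_burkNodeS_root_le (hBK : Burkholder1991_keyFunction) {lam : ℝ} (hlam : 2 < lam) {M : ℝ} (hM : 0 < M)
    {σ : ℝ} (hσ0 : 0 < σ) (hσ1 : σ < 1) {V : ℚ} (hV : ((V : ℚ) : ℝ) = M ^ 2) (T : Tree) (hT : T.valid = true)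
    (hsup : T.vortSup ≤ V) :
    T.leafSumR (burkNodeS lam M σ) Grad.zero 1 ≤ abar lam := by
  have h := leafSumR_burkNodeS_le hBK hlam hM hσ0 hσ1 hV T hT Grad.zero 1 zero_le_one hsup
  rw [burkNodeS_zero hlam] at h
  simpa using h

/-- **Leaves are recovered along the scaling path**: on a valid tree whose nodes obey `|ω|² ≤ M²`, for every `δ > 0`,
eventually (`σ → 1⁻`) `Σ_L W_L u(leaf) − δ·W ≤ Σ_L W_L u_σ(leaf)` (finitely many leaves, `uProf_path_eventually_ge` at each).
[ours; elementary] -/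
theorem leafSumR_burkNode_eventually_le {lam : ℝ} (hlam : 2 < lam) {M : ℝ} (hM : 0 < M) {V : ℚ}
    (hV : ((V : ℚ) : ℝ) = M ^ 2) (T : Tree) (hT : T.valid = true) {δ : ℝ} (hδ : 0 < δ) :
    ∀ (G : Grad) (W : ℚ), 0 ≤ W → T.vortSupFrom G ≤ V →
      ∀ᶠ σ in 𝓝[<] (1 : ℝ),
        T.leafSumR (burkNode lam M) G W - δ * (W : ℝ) ≤ T.leafSumR (burkNodeS lam M σ) G W := by
  induction T with
  | leaf =>
      intro G W hW hsup
      have hv : (G.vortSq : ℝ) ≤ M ^ 2 := by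
        rw [← hV]; exact_mod_cast (show G.vortSq ≤ V by simpa [vortSupFrom] using hsup)
      have hr0 : 0 ≤ Real.sqrt (G.vortSq : ℝ) / M := by positivity
      have hr1 : Real.sqrt (G.vortSq : ℝ) / M ≤ 1 := by
        rw [div_le_one hM]
        calc Real.sqrt (G.vortSq : ℝ) ≤ Real.sqrt (M ^ 2) := Real.sqrt_le_sqrt hv
          _ = M := Real.sqrt_sq hM.le
      have hz : 0 ≤ Real.sqrt (2 * (G.sSq : ℝ)) / M := by positivity
      have hev := uProf_path_eventually_ge hlam hr0 hr1 hz hδ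
      filter_upwards [hev, eventually_path_mem] with σ h ⟨h0, _⟩
      simp only [leafSumR]
      rw [burkNode_eq_uProf hM, burkNodeS_eq_uProf hM h0.le]
      have hWR : (0 : ℝ) ≤ (W : ℝ) := by exact_mod_cast hW
      nlinarith [mul_le_mul_of_nonneg_left h hWR]
  | node s p m ihp ihm =>
      intro G W hW hsup
      obtain ⟨h0, h1, hdot, hp, hm⟩ := valid_node hT
      have hc := vortSupFrom_children s p m G
      have hP := ihp hp (G.layer (1 - s.lam) s) (W * s.lam) (mul_nonneg hW h0.le) (hc.1.trans hsup)
      have hM' := ihm hm (G.layer (-s.lam) s) (W * (1 - s.lam)) (mul_nonneg hW (by linarith)) (hc.2.trans hsup)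
      filter_upwards [hP, hM'] with σ h1' h2'
      simp only [leafSumR]
      push_cast at h1' h2' ⊢
      nlinarith [h1', h2']

/-- **(TB) THE TREE INEQUALITY** (bank K1Q1-LAMINATE-BURKHOLDER §2 (TB); kernel, CONDITIONAL on the Burkholder named
fact): for every valid div-free lamination tree with `M²(𝒯) ≤ V = M²` (`M > 0`) and every `λ > 2`,
`Σ_L W_L u_λ(ω_L/M, √2 S_L/M) ≤ ᾱ_λ = (e²/4)e^{−λ}`.  Proof: the scaled inequality `leafSumR_burkNodeS_root_le` for every
`σ ∈ (0,1)` and `σ → 1⁻` leaf by leaf. [ours; conditional on `Burkholder1991_keyFunction`] -/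
theorem leafSumR_burkNode_root_le (hBK : Burkholder1991_keyFunction) {lam : ℝ} (hlam : 2 < lam) {M : ℝ}
    (hM : 0 < M) {V : ℚ} (hV : ((V : ℚ) : ℝ) = M ^ 2) (T : Tree) (hT : T.valid = true) (hsup : T.vortSup ≤ V) :
    T.leafSumR (burkNode lam M) Grad.zero 1 ≤ abar lam := by
  have key : ∀ δ : ℝ, 0 < δ → T.leafSumR (burkNode lam M) Grad.zero 1 ≤ abar lam + δ := by
    intro δ hδ
    have hev := leafSumR_burkNode_eventually_le hlam hM hV T hT hδ Grad.zero 1 zero_le_one hsup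
    have hev2 : ∀ᶠ σ in 𝓝[<] (1 : ℝ), T.leafSumR (burkNodeS lam M σ) Grad.zero 1 ≤ abar lam := by
      filter_upwards [eventually_path_mem] with σ ⟨h0, h1⟩
      exact leafSumR_burkNodeS_root_le hBK hlam hM h0 h1 hV T hT hsup
    obtain ⟨σ, hσ1, hσ2⟩ := (hev.and hev2).exists
    push_cast at hσ1
    linarith
  by_contra hcon
  have hlt : abar lam < T.leafSumR (burkNode lam M) Grad.zero 1 := not_le.1 hcon
  have := key ((T.leafSumR (burkNode lam M) Grad.zero 1 - abar lam) / 2) (by linarith)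
  linarith

end Tree

end Laminate

end Summit.NavierStokesRegularity.FunctionalMining

end
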